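/-
Copyright: the b2b-balaban T⁴-continuum CRUX team, row NE7b leaf lineage `t4-ne7b-formalise-leaf-06` (gen 160). Project licence.
-/
import Summits.QuantumFields.BalabanUV.T4Continuum.Spine.NE7b.HardStepChartRadius
import Summits.QuantumFields.BalabanUV.T4Continuum.Spine.NE7b.HardStepBranchDeriv
import Summits.QuantumFields.BalabanUV.T4Continuum.Spine.NE7b.HardStepBranchDerivModulus

/-!
# THE HARD STEP's INDUCTIVE STEP IN EQUATION-MAP FORM, IN ANY BANACH CURRENCY — the sup road's shape: a FIELD-EQUATION MAP
# `Eq : E → E` (no functional, no inner product, no dual fibre), a kept map `Q`, a lift `Lp`, the PRIMAL fibre `K`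
# with its projection `P` (`ι(P h) = h − Lp(Q h)`), a chart `T h = (Q h, P(A h))` with `‖T⁻¹‖ ≤ N` AS HYPOTHESIS, and the smallness
# `‖P∘(Eq′ x − A)‖ ≤ c < N⁻¹` on a ball ⟹ the background branch `σ` with all its letters, THE LIFT IDENTITY `Eq(σ w) = Lp(Q(Eq(σ w)))`,
# and THE NEXT EQUATION MAP `Eq⁺ := Q ∘ Eq ∘ σ` with its `C¹` letters — zeros of `Eq⁺` lift to zeros of `Eq`
# (row NE7b, node U5c; the junction the OWNER named «the next real one» after (57)∕(58)∕(60): `…HardStepInductiveStep` is Hilbert-typed;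
# HSCR ∕ HSBD ∕ HSBDM BY NAME, all normed-space generic; [folklore])

Cell `pub-balaban`, sub-cell `t4`, spine estimate NE7b (`T4WeightBudget.RelWeightBound`; the cell's OWN estimate — NOT PRINTED in
[Bałaban 1983–89], NOT PROVED).  Crux-route work under `Spine/NE7b/` by a row leaf (`t4-ne7b-formalise-leaf-06` gen 160) under FREEZE
(0)'s crux-prover clause, on the row OWNER's word (`t4-ne7b-p1` g114 CLOSE: «a sup-currency INDUCTIVE STEP (HSIS is Hilbert-typed) is
the next real junction — yours to claim first»; PRICING-NE7b v131 §3 names it among the next junctions).  NOTHING of Bałaban's is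
named as a Lean object, valued or asserted; no `T4Continuum/Support` leaf typed; no `def`; zero `sorry`.  Imports (BY NAME, all typed
on general real normed spaces): `…HardStepChartRadius` (HSCR `exists_branch_chart`), `…HardStepBranchDeriv` (HSBD
`hasFDerivAt_sliceBranch_of_chart`, `fst_comp_symm_comp_inl`, `snd_comp_symm_comp_inl`), `…HardStepBranchDerivModulus` (HSBDM
`norm_fderiv_sub_fderiv_le_mul_of_chart`).

WHY (located).  `…HardStepInductiveStep` (HSIS) runs the hard step's induction in HESSIAN currency on a Hilbert `E`: the chart comes
from kernel coercivity (AHE), the fibre is the DUAL `(ker D →L ℝ)`, and the step transports a functional `V ↦ V ∘ σ`.  On the sup road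
none of the three is available: on `ℓ^∞(ℤ^d)` the action is infinite while the FIELD EQUATION is a pointwise map ((58):
`Eq φ = Aφ + u∘φ`), the fibre is the PRIMAL `ker Q′` with `P = 1 − Q′*Q′` ((57) ∕ (60)), the chart is ASE's `exists_aug_equiv_sup`
(every side, the same `N_∞`), and a chart `ℓ^∞ ≃L ℓ^∞ × (ker Q′ →L ℝ)` does not exist.  What survives is exactly what the generic
chart files prove: HSCR's branch, HSBD's derivative, HSBDM's modulus — for ANY `C¹` transversal map (the instance's `Q∘Lp = 1` makes `ι∘P` a projection but is NOT
consumed: only the letter `ι(P h) = h − Lp(Q h)` is).  THIS FILE assembles them for an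
EQUATION MAP and adds the two identities that make the step iterate WITHOUT a functional: (i) the LIFT IDENTITY — fibre-criticality
`P(Eq(σ w)) = 0` says the fine equation at the background is the lift of a coarse field, `Eq(σ w) = Lp(Q(Eq(σ w)))`; (ii) hence the NEXT
EQUATION MAP is `Eq⁺ := Q ∘ Eq ∘ σ : F → F` (the Lagrange-multiplier field; in finite volume `∇(S ∘ σ)(w) = vol·Eq⁺(w)` by `Q ∘ Dσ = 1` —
a pairing remark, not typed), with `Eq(σ w) = Lp(Eq⁺ w)`: every zero of `Eq⁺` in the chart ball IS a zero of `Eq`.  Its `C¹` letters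
(`‖DEq⁺‖ ≤ ‖Q‖BK₁`, Lipschitz modulus `‖Q‖(M₃K₁² + BΛ)`) are the next step's `hE` ∕ `hB` ∕ `hM` inputs on `F`.

WHAT IS PROVED ([folklore]; `E F K` real normed spaces, `E` complete and nontrivial in §3; `K₁ := (N⁻¹ − c)⁻¹`, `ρ := (N⁻¹ − c)·r`):
* §1 `eq_lift_of_proj_eq_zero` (`ι(P h) = h − Lp(Q h)` and `P h = 0` ⟹ `h = Lp(Q h)`), `norm_prod_sub_prod_le` (`‖(Q, L₁) − (Q, L₂)‖ ≤ ‖L₁ − L₂‖`),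
  `norm_comp_sub_comp_le` (`‖P∘X − P∘Y‖ ≤ ‖P‖‖X − Y‖`), `norm_comp_comp_sub_le` (the product-rule modulus
  `‖Q∘X∘U − Q∘Y∘W‖ ≤ ‖Q‖(‖X − Y‖‖U‖ + ‖Y‖‖U − W‖)`).
* §2 **`inductiveStep_eq`** — the scale-`k` letters above ⟹ `∃ σ : F → E`, `σ 0 = 0`, and
  (a) on `closedBall 0 ρ`: `σ w ∈ closedBall 0 r`, `Q(σ w) = w`, `P(Eq(σ w)) = 0`, **`Eq(σ w) = Lp(Q(Eq(σ w)))`**; `σ` is `K₁`-Lipschitz there;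
      uniqueness: every `x` in the `r`-ball with `P(Eq x) = 0` is `σ(Q x)`;
  (b) on `ball 0 ρ`: `σ` differentiable, `‖Dσ w‖ ≤ K₁`, `Q ∘ Dσ(w) = 1`, `P(Eq′(σ w)(Dσ(w) k)) = 0` (pointwise in `K` — no `K`-valued
      operator algebra in the statement, so that `K = ker Q′ ⊂ ℓ^∞` instantiates without the subtype's topological-group search), and
      `‖Dσ w − Dσ w′‖ ≤ K₁²·(C_P M₃)·K₁·‖w − w′‖`;
  (c) THE NEXT EQUATION MAP `w ↦ Q(Eq(σ w))`: value `0` at `0`; on `ball 0 ρ`: `HasFDerivAt (Q∘Eq∘σ) (Q∘Eq′(σ w)∘Dσ(w)) w`,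
      `‖Q∘Eq′(σ w)∘Dσ(w)‖ ≤ ‖Q‖·B·K₁`,
      `‖Q∘Eq′(σ w)∘Dσ(w) − Q∘Eq′(σ w′)∘Dσ(w′)‖ ≤ ‖Q‖·(M₃K₁·K₁ + B·(K₁²C_PM₃K₁))·‖w − w′‖`;
  (d) on `closedBall 0 ρ`: `Eq(σ w) = Lp(Q(Eq(σ w)))` read as **`Q(Eq(σ w)) = 0 → Eq(σ w) = 0`** — zeros of the next equation lift.
* §3 toy: `E = F = K = ℝ`-free sanity of §1's algebra (`example`).

NOT HERE (honest): the NEXT CHART `(T⁺, N⁺)` reading `(Q⁺, P⁺∘DEq⁺(0))` and the next radius ∕ rescaling (displayed inputs of the next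
step, as HSIS displays `m⁺` ∕ `c⁺`; for the free part ASE at the next side is the candidate); the `ℓ^∞(ℤ^d)` INSTANCE (`Q = Dop`,
`Lp c = c ∘ blk`, `ι∘P = Pop`, `Eq = Aop + Nu`, `A = Aop`, `c = 2λ`, `T`, `N_∞` from ASE + (58) — the successor of the OWNER's (60));
the pairing identity `∇(S∘σ) = vol·Q∘Eq∘σ` (finite volume only); anything of (A3) ∕ (A1c); NC-NE7b-α UNRULED; anything of Bałaban's.
BY-NAME EFFECT ON THE WALL: NONE.  NE7b NOT PRINTED ∕ NOT PROVED; spine PROVED 0∕9; rung (B)+1 on a FINITE torus — NOT infinite volume,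
NOT the mass gap, NOT Clay.  HONEST DEPENDENCY: continuum YM on T⁴ ⇐ BetaPertH ∧ nine spine estimates (0∕9 proved); BetaPertH ⇐ (D1) ∧
(D4) ∧ CAP+tail; G-an2-4 gates asym, D1 and NE2∕3∕4.
-/

set_option autoImplicit false

noncomputable section

namespace Summit.QuantumFields.BalabanUV.T4Continuum.NE7b.SupInductiveStep

open Set Metric Function
open scoped NNReal
open Summit.QuantumFields.BalabanUV.T4Continuum.NE7b

variable {E F K : Type*} [NormedAddCommGroup E] [NormedSpace ℝ E] [NormedAddCommGroup F] [NormedSpace ℝ F]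
  [NormedAddCommGroup K] [NormedSpace ℝ K]

/-! ## §1. The fibre projection read in `K`, and three operator-norm inequalities -/

/-- **THE LIFT LEMMA**: if `ι(P h) = h − Lp(Q h)` for all `h` (the fibre projection read in `K`) and `P h = 0`, then `h = Lp(Q h)` —
a field killed by the fibre projection is the lift of its coarse image. [folklore] -/
theorem eq_lift_of_proj_eq_zero {Q : E →L[ℝ] F} {Lp : F →L[ℝ] E} {P : E →L[ℝ] K} {ι : K →L[ℝ] E}
    (hPι : ∀ h, ι (P h) = h - Lp (Q h)) {h : E} (hP : P h = 0) : h = Lp (Q h) := by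
  have e := hPι h
  rw [hP, map_zero] at e
  exact (sub_eq_zero.mp e.symm)

omit [NormedSpace ℝ E] in
/-- `‖(Q, L₁) − (Q, L₂)‖ ≤ ‖L₁ − L₂‖` for the product maps (sup norm on the product). [folklore] -/
theorem norm_prod_sub_prod_le [NormedSpace ℝ E] (Q : E →L[ℝ] F) (L₁ L₂ : E →L[ℝ] K) : ‖Q.prod L₁ - Q.prod L₂‖ ≤ ‖L₁ - L₂‖ := by
  have h1 : Q.prod L₁ - Q.prod L₂ = (0 : E →L[ℝ] F).prod (L₁ - L₂) := by ext h <;> simp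
  rw [h1, ContinuousLinearMap.opNorm_prod, Prod.norm_def, norm_zero, max_eq_right (norm_nonneg _)]

/-- `‖P∘X − P∘Y‖ ≤ ‖P‖·‖X − Y‖`. [folklore] -/
theorem norm_comp_sub_comp_le (P : E →L[ℝ] K) (X Y : E →L[ℝ] E) : ‖P.comp X - P.comp Y‖ ≤ ‖P‖ * ‖X - Y‖ := by
  rw [← ContinuousLinearMap.comp_sub]
  exact ContinuousLinearMap.opNorm_comp_le _ _

/-- **THE PRODUCT-RULE MODULUS**: `‖Q∘X∘U − Q∘Y∘W‖ ≤ ‖Q‖·(‖X − Y‖·‖U‖ + ‖Y‖·‖U − W‖)`. [folklore] -/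
theorem norm_comp_comp_sub_le (Q : E →L[ℝ] F) (X Y : E →L[ℝ] E) (U W : F →L[ℝ] E) :
    ‖Q.comp (X.comp U) - Q.comp (Y.comp W)‖ ≤ ‖Q‖ * (‖X - Y‖ * ‖U‖ + ‖Y‖ * ‖U - W‖) := by
  have h1 : Q.comp (X.comp U) - Q.comp (Y.comp W) = Q.comp ((X - Y).comp U + Y.comp (U - W)) := by
    ext v
    simp only [sub_apply, ContinuousLinearMap.comp_apply, add_apply, map_sub, map_add]
    abel
  rw [h1]
  refine (ContinuousLinearMap.opNorm_comp_le _ _).trans (mul_le_mul_of_nonneg_left ?_ (norm_nonneg _))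
  exact (norm_add_le _ _).trans (add_le_add (ContinuousLinearMap.opNorm_comp_le _ _) (ContinuousLinearMap.opNorm_comp_le _ _))

/-! ## §2. THE INDUCTIVE STEP IN EQUATION-MAP FORM -/

/-- **ONE INDUCTIVE STEP OF THE HARD-STEP ROAD FOR AN EQUATION MAP, ANY BANACH CURRENCY.**  Data: kept map `Q`, lift `Lp`, fibre
projection `P` into `K` read by `ι(P h) = h − Lp(Q h)` (the only letter of `Lp` consumed), `‖P‖ ≤ C_P`; equation map `Eq` with `Eq 0 = 0`, derivative `Eq′` on
`closedBall 0 r`, `‖Eq′ x‖ ≤ B`, `‖Eq′ x − Eq′ x′‖ ≤ M₃‖x − x′‖`; linear part `A` with chart `T h = (Q h, P(A h))`, `‖T⁻¹ y‖ ≤ N‖y‖`;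
smallness `‖P∘(Eq′ x − A)‖ ≤ c` on the ball, `c < N⁻¹`.  Conclusions: the branch (a), its derivative letters (b), the NEXT equation map
`Q∘Eq∘σ` with its `C¹` letters (c), and the lift of zeros (d). [folklore] -/
theorem inductiveStep_eq [CompleteSpace E] [Nontrivial E]
    (Q : E →L[ℝ] F) (Lp : F →L[ℝ] E) (P : E →L[ℝ] K) (ι : K →L[ℝ] E)
    (hPι : ∀ h, ι (P h) = h - Lp (Q h)) {CP : ℝ} (hCP : ‖P‖ ≤ CP)
    {Eq : E → E} {Eq' : E → E →L[ℝ] E} (hE0 : Eq 0 = 0) {r : ℝ} (hr : 0 ≤ r)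
    (hE : ∀ x ∈ closedBall (0 : E) r, HasFDerivAt Eq (Eq' x) x)
    {B M₃ : ℝ} (hB : ∀ x ∈ closedBall (0 : E) r, ‖Eq' x‖ ≤ B) (hM₃ : 0 ≤ M₃)
    (hM : ∀ x ∈ closedBall (0 : E) r, ∀ x' ∈ closedBall (0 : E) r, ‖Eq' x - Eq' x'‖ ≤ M₃ * ‖x - x'‖)
    (A : E →L[ℝ] E) (T : E ≃L[ℝ] F × K) (hT : ∀ h, T h = (Q h, P (A h))) {N c : ℝ≥0}
    (hN : ∀ y : F × K, ‖T.symm y‖ ≤ N * ‖y‖) (hcN : c < N⁻¹)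
    (hc : ∀ x ∈ closedBall (0 : E) r, ‖P.comp (Eq' x - A)‖ ≤ c) :
    ∃ σ : F → E, σ 0 = 0 ∧
      -- (a) the branch on the closed chart ball, the lift identity, Lipschitz, uniqueness
      (∀ w ∈ closedBall (0 : F) (((N : ℝ)⁻¹ - c) * r),
        σ w ∈ closedBall (0 : E) r ∧ Q (σ w) = w ∧ P (Eq (σ w)) = 0 ∧ Eq (σ w) = Lp (Q (Eq (σ w)))) ∧
      LipschitzOnWith (N⁻¹ - c)⁻¹ σ (closedBall (0 : F) (((N : ℝ)⁻¹ - c) * r)) ∧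
      (∀ x ∈ closedBall (0 : E) r, P (Eq x) = 0 → σ (Q x) = x) ∧
      -- (b) the derivative letters on the open chart ball
      (∀ w ∈ ball (0 : F) (((N : ℝ)⁻¹ - c) * r), DifferentiableAt ℝ σ w ∧ ‖fderiv ℝ σ w‖ ≤ ((N : ℝ)⁻¹ - c)⁻¹ ∧
        Q.comp (fderiv ℝ σ w) = ContinuousLinearMap.id ℝ F ∧ ∀ k, P (Eq' (σ w) (fderiv ℝ σ w k)) = 0) ∧
      (∀ w ∈ ball (0 : F) (((N : ℝ)⁻¹ - c) * r), ∀ w' ∈ ball (0 : F) (((N : ℝ)⁻¹ - c) * r),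
        ‖fderiv ℝ σ w - fderiv ℝ σ w'‖ ≤ (((N : ℝ)⁻¹ - c)⁻¹) ^ 2 * (CP * M₃) * ((N : ℝ)⁻¹ - c)⁻¹ * ‖w - w'‖) ∧
      -- (c) the next equation map `Q ∘ Eq ∘ σ` and its `C¹` letters
      Q (Eq (σ 0)) = 0 ∧
      (∀ w ∈ ball (0 : F) (((N : ℝ)⁻¹ - c) * r),
        HasFDerivAt (fun w => Q (Eq (σ w))) (Q.comp ((Eq' (σ w)).comp (fderiv ℝ σ w))) w ∧
        ‖Q.comp ((Eq' (σ w)).comp (fderiv ℝ σ w))‖ ≤ ‖Q‖ * B * ((N : ℝ)⁻¹ - c)⁻¹) ∧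
      (∀ w ∈ ball (0 : F) (((N : ℝ)⁻¹ - c) * r), ∀ w' ∈ ball (0 : F) (((N : ℝ)⁻¹ - c) * r),
        ‖Q.comp ((Eq' (σ w)).comp (fderiv ℝ σ w)) - Q.comp ((Eq' (σ w')).comp (fderiv ℝ σ w'))‖ ≤
          ‖Q‖ * (M₃ * ((N : ℝ)⁻¹ - c)⁻¹ * ((N : ℝ)⁻¹ - c)⁻¹ +
            B * ((((N : ℝ)⁻¹ - c)⁻¹) ^ 2 * (CP * M₃) * ((N : ℝ)⁻¹ - c)⁻¹)) * ‖w - w'‖) ∧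
      -- (d) zeros of the next equation lift to zeros of `Eq`
      (∀ w ∈ closedBall (0 : F) (((N : ℝ)⁻¹ - c) * r), Q (Eq (σ w)) = 0 → Eq (σ w) = 0) := by
  -- the transversal map `g := P ∘ Eq` and its linear part `P ∘ A`
  have hT' : ∀ h, T h = (Q h, (P.comp A) h) := fun h => by rw [hT]; rfl
  have hgD : ∀ x ∈ closedBall (0 : E) r, HasFDerivAt (fun x => P (Eq x)) (P.comp (Eq' x)) x := fun x hx =>
    P.hasFDerivAt.comp x (hE x hx)
  have hgd : ∀ x ∈ closedBall (0 : E) r, DifferentiableAt ℝ (fun x => P (Eq x)) x := fun x hx =>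
    (hgD x hx).differentiableAt
  have hgc : ∀ x ∈ closedBall (0 : E) r, ‖fderiv ℝ (fun x => P (Eq x)) x - P.comp A‖ ≤ c := fun x hx => by
    rw [(hgD x hx).fderiv, ← ContinuousLinearMap.comp_sub]; exact hc x hx
  -- HSCR: the branch at the base point 0
  obtain ⟨σ, hσ0, hσ, hlip, huniq⟩ :=
    HardStepChartRadius.exists_branch_chart Q (P.comp A) T hT' (δ₀ := 0) hr hN hcN hgd hgc
  rw [map_zero] at hσ0 hσ hlip
  have hg0 : P (Eq 0) = 0 := by rw [hE0, map_zero]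
  -- constants
  have hc' : (c : ℝ) < (N : ℝ)⁻¹ := by
    have h := NNReal.coe_lt_coe.2 hcN
    rwa [NNReal.coe_inv] at h
  have hpos : (0 : ℝ) < (N : ℝ)⁻¹ - c := sub_pos.2 hc'
  have hK0 : (0 : ℝ) ≤ ((N : ℝ)⁻¹ - c)⁻¹ := inv_nonneg.2 hpos.le
  have hcoe : (((N⁻¹ - c)⁻¹ : ℝ≥0) : ℝ) = ((N : ℝ)⁻¹ - c)⁻¹ := by
    rw [NNReal.coe_inv, NNReal.coe_sub hcN.le, NNReal.coe_inv]
  have hCP0 : 0 ≤ CP := (norm_nonneg P).trans hCP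
  -- (a)
  have hA : ∀ w ∈ closedBall (0 : F) (((N : ℝ)⁻¹ - c) * r),
      σ w ∈ closedBall (0 : E) r ∧ Q (σ w) = w ∧ P (Eq (σ w)) = 0 ∧ Eq (σ w) = Lp (Q (Eq (σ w))) := fun w hw => by
    obtain ⟨h1, h2, h3⟩ := hσ w hw
    have h3' : P (Eq (σ w)) = 0 := by
      have e : (fun x => P (Eq x)) (σ w) = (fun x => P (Eq x)) 0 := h3
      simpa only [hg0] using e
    exact ⟨h1, h2, h3', eq_lift_of_proj_eq_zero hPι h3'⟩
  have hσr : ∀ w ∈ ball (0 : F) (((N : ℝ)⁻¹ - c) * r), σ w ∈ closedBall (0 : E) r := fun w hw =>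
    (hA w (ball_subset_closedBall hw)).1
  have hσLip : ∀ w ∈ ball (0 : F) (((N : ℝ)⁻¹ - c) * r), ∀ w' ∈ ball (0 : F) (((N : ℝ)⁻¹ - c) * r),
      ‖σ w - σ w'‖ ≤ ((N : ℝ)⁻¹ - c)⁻¹ * ‖w - w'‖ := fun w hw w' hw' => by
    have h := hlip.dist_le_mul w (ball_subset_closedBall hw) w' (ball_subset_closedBall hw')
    rw [dist_eq_norm, dist_eq_norm, hcoe] at h
    exact h
  -- HSBD on the chart map `Φ = (Q, P ∘ Eq)`, `Φ′ x = (Q, P ∘ Eq′ x)`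
  have hTe : (T : E →L[ℝ] F × K) = Q.prod (P.comp A) := by
    ext h <;> simp [hT h]
  have hΦd : ∀ x ∈ closedBall (0 : E) r,
      HasFDerivAt (fun x => (Q x, P (Eq x))) (Q.prod (P.comp (Eq' x))) x := fun x hx =>
    Q.hasFDerivAt.prodMk (P.hasFDerivAt.comp x (hE x hx))
  have hΦc : ∀ x ∈ closedBall (0 : E) r, ‖Q.prod (P.comp (Eq' x)) - (T : E →L[ℝ] F × K)‖ ≤ c := fun x hx => by
    rw [hTe]; refine (norm_prod_sub_prod_le Q _ _).trans ?_
    rw [← ContinuousLinearMap.comp_sub]; exact hc x hx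
  have hσ' : ∀ w ∈ closedBall (0 : F) (((N : ℝ)⁻¹ - c) * r), σ w ∈ closedBall (0 : E) r ∧
      ((fun x => (Q x, P (Eq x))) (σ w)).1 = w ∧ ((fun x => (Q x, P (Eq x))) (σ w)).2 = 0 := fun w hw => by
    obtain ⟨h1, h2, h3, -⟩ := hA w hw
    exact ⟨h1, h2, h3⟩
  have hBr := fun w (hw : w ∈ ball (0 : F) (((N : ℝ)⁻¹ - c) * r)) =>
    HardStepBranchDeriv.hasFDerivAt_sliceBranch_of_chart T hN hcN hΦd hΦc hσ' hlip.continuousOn hw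
  -- (b) pointwise
  have hBpt : ∀ w ∈ ball (0 : F) (((N : ℝ)⁻¹ - c) * r), DifferentiableAt ℝ σ w ∧ ‖fderiv ℝ σ w‖ ≤ ((N : ℝ)⁻¹ - c)⁻¹ ∧
      Q.comp (fderiv ℝ σ w) = ContinuousLinearMap.id ℝ F ∧ ∀ k, P (Eq' (σ w) (fderiv ℝ σ w k)) = 0 := fun w hw => by
    obtain ⟨Aw, hAeq, -, hd, hn⟩ := hBr w hw
    have hAw : ∀ h, Aw h = (Q h, (P.comp (Eq' (σ w))) h) := fun h => by
      rw [← ContinuousLinearEquiv.coe_coe, hAeq, ContinuousLinearMap.prod_apply]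
    refine ⟨hd.differentiableAt, by rwa [hd.fderiv], ?_, fun k => ?_⟩
    · rw [hd.fderiv]; exact HardStepBranchDeriv.fst_comp_symm_comp_inl Aw Q _ hAw
    · have h0 := HardStepBranchDeriv.snd_comp_symm_comp_inl Aw Q _ hAw
      rw [hd.fderiv]
      exact congrArg (fun L : F →L[ℝ] K => L k) h0
  -- (b) two-point: HSBDM with `Φ′` `(C_P M₃)`-Lipschitz
  have hΦ'lip : ∀ x ∈ closedBall (0 : E) r, ∀ x' ∈ closedBall (0 : E) r,
      ‖Q.prod (P.comp (Eq' x)) - Q.prod (P.comp (Eq' x'))‖ ≤ CP * M₃ * ‖x - x'‖ := fun x hx x' hx' =>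
    (norm_prod_sub_prod_le Q _ _).trans ((norm_comp_sub_comp_le P _ _).trans (by
      calc ‖P‖ * ‖Eq' x - Eq' x'‖ ≤ CP * (M₃ * ‖x - x'‖) := mul_le_mul hCP (hM x hx x' hx') (norm_nonneg _) hCP0
        _ = CP * M₃ * ‖x - x'‖ := by ring))
  have hσ'' : ∀ w ∈ ball (0 : F) (((N : ℝ)⁻¹ - c) * r), ∃ Aw : E ≃L[ℝ] F × K,
      (Aw : E →L[ℝ] F × K) = Q.prod (P.comp (Eq' (σ w))) ∧ (∀ z, ‖Aw.symm z‖ ≤ ((N : ℝ)⁻¹ - c)⁻¹ * ‖z‖) ∧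
      HasFDerivAt σ ((Aw.symm : F × K →L[ℝ] E).comp (ContinuousLinearMap.inl ℝ F K)) w := fun w hw => by
    obtain ⟨Aw, hAeq, hAinv, hd, -⟩ := hBr w hw
    exact ⟨Aw, hAeq, hAinv, hd⟩
  have hΛ : ∀ w ∈ ball (0 : F) (((N : ℝ)⁻¹ - c) * r), ∀ w' ∈ ball (0 : F) (((N : ℝ)⁻¹ - c) * r),
      ‖fderiv ℝ σ w - fderiv ℝ σ w'‖ ≤ (((N : ℝ)⁻¹ - c)⁻¹) ^ 2 * (CP * M₃) * ((N : ℝ)⁻¹ - c)⁻¹ * ‖w - w'‖ :=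
    fun w hw w' hw' =>
    HardStepBranchDerivModulus.norm_fderiv_sub_fderiv_le_mul_of_chart (Φ' := fun x => Q.prod (P.comp (Eq' x)))
      hK0 (mul_nonneg hCP0 hM₃) hΦ'lip hσr hσLip hσ'' hw hw'
  -- (c) the next equation map
  have hB0 : ∀ w ∈ ball (0 : F) (((N : ℝ)⁻¹ - c) * r), 0 ≤ B := fun w hw => (norm_nonneg _).trans (hB _ (hσr w hw))
  have hC : ∀ w ∈ ball (0 : F) (((N : ℝ)⁻¹ - c) * r),
      HasFDerivAt (fun w => Q (Eq (σ w))) (Q.comp ((Eq' (σ w)).comp (fderiv ℝ σ w))) w ∧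
      ‖Q.comp ((Eq' (σ w)).comp (fderiv ℝ σ w))‖ ≤ ‖Q‖ * B * ((N : ℝ)⁻¹ - c)⁻¹ := fun w hw => by
    obtain ⟨hd, hn, -, -⟩ := hBpt w hw
    refine ⟨Q.hasFDerivAt.comp w ((hE _ (hσr w hw)).comp w hd.hasFDerivAt), ?_⟩
    refine (ContinuousLinearMap.opNorm_comp_le _ _).trans ?_
    rw [mul_assoc]
    refine mul_le_mul_of_nonneg_left ?_ (norm_nonneg _)
    exact (ContinuousLinearMap.opNorm_comp_le _ _).trans (mul_le_mul (hB _ (hσr w hw)) hn (norm_nonneg _) (hB0 w hw))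
  refine ⟨σ, hσ0, hA, hlip, fun x hx hPx => huniq x hx (by simp only [hPx, hg0]), hBpt, hΛ, ?_, hC, ?_, ?_⟩
  · -- (c) value at 0
    rw [hσ0, hE0, map_zero]
  · -- (c) two-point modulus of the next derivative
    intro w hw w' hw'
    obtain ⟨-, hn, -, -⟩ := hBpt w hw
    refine (norm_comp_comp_sub_le Q _ _ _ _).trans ?_
    rw [mul_assoc]
    refine mul_le_mul_of_nonneg_left ?_ (norm_nonneg _)
    have h1 := hM _ (hσr w hw) _ (hσr w' hw')
    have h2 := hσLip w hw w' hw'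
    have h3 := hΛ w hw w' hw'
    have h4 := hB _ (hσr w' hw')
    have hww : 0 ≤ ‖w - w'‖ := norm_nonneg _
    calc ‖Eq' (σ w) - Eq' (σ w')‖ * ‖fderiv ℝ σ w‖ + ‖Eq' (σ w')‖ * ‖fderiv ℝ σ w - fderiv ℝ σ w'‖
        ≤ (M₃ * (((N : ℝ)⁻¹ - c)⁻¹ * ‖w - w'‖)) * ((N : ℝ)⁻¹ - c)⁻¹ +
            B * ((((N : ℝ)⁻¹ - c)⁻¹) ^ 2 * (CP * M₃) * ((N : ℝ)⁻¹ - c)⁻¹ * ‖w - w'‖) := by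
          refine add_le_add (mul_le_mul (h1.trans (mul_le_mul_of_nonneg_left h2 hM₃)) hn (norm_nonneg _) (by positivity))
            (mul_le_mul h4 h3 (norm_nonneg _) (hB0 w hw))
      _ = (M₃ * ((N : ℝ)⁻¹ - c)⁻¹ * ((N : ℝ)⁻¹ - c)⁻¹ +
            B * ((((N : ℝ)⁻¹ - c)⁻¹) ^ 2 * (CP * M₃) * ((N : ℝ)⁻¹ - c)⁻¹)) * ‖w - w'‖ := by ring
  · -- (d) zeros lift
    intro w hw h0
    rw [(hA w hw).2.2.2, h0, map_zero]

/-! ## §3. Toy -/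

/-- Toy: the lift lemma on `E = F = K = ℝ` with `Q = Lp = id`, `P = 0`, `ι = id`: `ι(P h) = 0 = h − h`, and `P h = 0` gives `h = Lp(Q h)`. -/
example (h : ℝ) : h = (ContinuousLinearMap.id ℝ ℝ) ((ContinuousLinearMap.id ℝ ℝ) h) :=
  eq_lift_of_proj_eq_zero (Q := ContinuousLinearMap.id ℝ ℝ) (Lp := ContinuousLinearMap.id ℝ ℝ) (P := (0 : ℝ →L[ℝ] ℝ))
    (ι := ContinuousLinearMap.id ℝ ℝ) (fun h => by simp) (h := h) rfl

end Summit.QuantumFields.BalabanUV.T4Continuum.NE7b.SupInductiveStep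

end
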